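import Summits.QuantumFields.YangMills.Theorems.ColdStartUniversalityLatticeLangevinLawDensityBoundExplicit
import Summits.QuantumFields.YangMills.Theorems.ColdStartUniversalityLatticeLangevinBakryEmeryKLBudget
import Literature.MathematicalPhysics.QuantumFieldTheory.Balaban1983to89.MassGapTransferHC
import HarnessLib

/-!
# Route `ColdStartUniversality` (fixed-cut-off package, explicit constants): EXPLICIT COLD-START ENTROPY BUDGET `KL ≤ B_L = O(L³)` and
# LOGARITHMIC-IN-THE-VOLUME MIXING TIME of the SU(2) SZZ dynamics on `(ℤ/L)³` at `|β'| < 1/12`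

Helper file (seat `ym-line-csu-p1`, g27; `--supports stmt-QuantumFields-24809`).  With the explicit density bound
`map_le_smul_haar_of_le_explicit` (burn-in time `t₁ = 2` lattice units) and the explicit Wilson/Haar comparison, g26's entropy budget
and cold-start mixing statements become QUANTITATIVE IN THE VOLUME:
* ★★ `wilson_klDiv_map_le_explicit` — every coupling `β'`, every deterministic start `z`, EVERY solution on ANY space, every `s ≥ 0`:
  `KL(law(U_(2+s)) ‖ μ_(β')) ≤ B_L(β') := 366|β'|·L³ + 3·log(3/2)·L³ + log 2`;
* ★★ `wilson_coldStart_klDiv_le_exp_explicit` — at `|β'| < 1/12`: `KL(law(U_(2+u)) ‖ μ_(β')) ≤ e^(−2(1−12|β'|)u) · B_L(β')`;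
* ★★★ `wilson_coldStart_observable_le_exp_explicit` — for measurable `|g| ≤ 1`: `|E g(U_(2+u)) − μ_(β')(g)| ≤ e^(−(1−12|β'|)u) · √(2 B_L(β'))`;
* ★★★ `wilson_coldStart_mixingTime_log_volume` — for every `ε > 0` and every `u ≥ log(√(2B_L(β'))/ε) / (1 − 12|β'|)`:
  `|E g(U_(2+u)) − μ_(β')(g)| ≤ ε` for all measurable `|g| ≤ 1`, all starts, all solutions — i.e. the (bounded-observable / total-variation)
  MIXING TIME of the SZZ Langevin dynamics at strong coupling is at most `2 + log(√(2B_L)/ε)/(1−12|β'|) = O(log L + log(1/ε))`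
  lattice time units, UNIFORMLY IN THE START.
Ingredients: `integral_le_exp_mul_integral_beta_zero_explicit` (`K = 48|β'|#E`, `Mψ = 2|β'|#𝒫`), `map_le_smul_haar_beta_zero_explicit`
(`|h_2| ≤ 3/2`), `wilsonMeasure_le_smul_pi_haar_and_explicit` (`a = e^(8|β'|#𝒫)`), `#E = #𝒫 = 3L³`, `klDiv_le_log_of_le_smul`, the volume-uniform
KL decay `wilson_klDiv_map_le_exp_uniform` (g26) and Pinsker (`wilson_coldStart_observable_le_exp_uniform`).
[cite: ShenZhuZhu2022, §4 Theorem 4.2, Corollary 4.4]  THEOREMS ONLY, no definition, no sorry.  HONEST FRAMING: FIXED cut-off and fixed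
`|β'| < 1/12` (lattice units; "uniform" = in `L` and in the start); the route's scaling `β'_K → ∞` leaves the window; 24809 ASIDE not restated;
no crux, rung or summit statement is proved; the Yang–Mills mass gap is NOT proved.
-/

set_option autoImplicit false

noncomputable section

namespace Summit.QuantumFields.YangMills.Theorems.ColdStartUniversality

open MeasureTheory ProbabilityTheory Finset Filter Set InformationTheory
open scoped BigOperators NNReal ENNReal Topology
open Literature.Probability.Process Literature.MathematicalPhysics.QuantumFieldTheory
open Literature.MathematicalPhysics.QuantumLattice (fundamentalRep fundamentalLatticeRep continuous_fundamentalRep)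

variable {L : ℕ} [NeZero L]

/-! ## §1. The explicit density constant is at most `exp B_L` -/

/-- `0 < B_L(β') = 366|β'|L³ + 3 log(3/2) L³ + log 2`. [folklore] -/
theorem burnInBudget_pos (L : ℕ) [NeZero L] (β' : ℝ) : 0 < (366 * |β'| * (L : ℝ) ^ 3 + 3 * Real.log (3 / 2) * (L : ℝ) ^ 3 + Real.log 2) := by
  have h1 : 0 < Real.log 2 := Real.log_pos (by norm_num)
  have h2 : 0 < Real.log (3 / 2 : ℝ) := Real.log_pos (by norm_num)
  positivity

/-- **The explicit density constant of `map_le_smul_haar_of_le_explicit` (`t₁ = 2`) times the Wilson/Haar constant is at most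
`exp(B_L(β'))`** (`#E = #𝒫 = 3L³`). [folklore] -/
theorem densityConstant_mul_le_exp_budget (L : ℕ) [NeZero L] (β' : ℝ) :
    ((Real.exp ((48 * |β'| * (Fintype.card (Edge 3 L) : ℝ)) * ((2 : ℝ≥0) : ℝ) + (2 * |β'| * (Fintype.card (Plaquette 3 L) : ℝ))) * (2 * (3 / 2 : ℝ) ^ Fintype.card (Edge 3 L))) * ((Real.exp (|β'| * (4 * (Fintype.card (Plaquette 3 L) : ℝ))) * Real.exp (|β'| * (4 * (Fintype.card (Plaquette 3 L) : ℝ)))) * (Real.exp (|β'| * (4 * (Fintype.card (Plaquette 3 L) : ℝ))) * Real.exp (|β'| * (4 * (Fintype.card (Plaquette 3 L) : ℝ)))))) * (Real.exp (|β'| * (4 * (Fintype.card (Plaquette 3 L) : ℝ))) * Real.exp (|β'| * (4 * (Fintype.card (Plaquette 3 L) : ℝ)))) ≤ Real.exp (366 * |β'| * (L : ℝ) ^ 3 + 3 * Real.log (3 / 2) * (L : ℝ) ^ 3 + Real.log 2) := by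
  have hE : (Fintype.card (Edge 3 L) : ℝ) = 3 * (L : ℝ) ^ 3 := by
    rw [Fintype.card_prod, card_site_three, Fintype.card_fin]; push_cast; ring
  have hP : (Fintype.card (Plaquette 3 L) : ℝ) = 3 * (L : ℝ) ^ 3 := by
    rw [card_plaquette_three]; push_cast; ring
  have e232 : (2 : ℝ) * (3 / 2 : ℝ) ^ Fintype.card (Edge 3 L) =
      Real.exp (Real.log 2 + (Fintype.card (Edge 3 L) : ℝ) * Real.log (3 / 2)) := by
    rw [Real.exp_add, Real.exp_log two_pos, Real.exp_nat_mul, Real.exp_log (by norm_num : (0 : ℝ) < 3 / 2)]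
  have h22 : ((2 : ℝ≥0) : ℝ) = 2 := by norm_num
  rw [e232, h22]
  simp only [← Real.exp_add]
  rw [Real.exp_le_exp, hE, hP]
  apply le_of_eq
  ring

/-! ## §2. The explicit entropy budget -/

/-- ★★ **Explicit cold-start entropy budget** (SU(2) SZZ dynamics on `(ℤ/L)³`, every coupling `β'`): for every deterministic start `z`,
EVERY solution `U` from `z` on ANY probability space and every `s ≥ 0`,
`KL(law(U_(2+s)) ‖ μ_(β')) ≤ 366|β'|·L³ + 3·log(3/2)·L³ + log 2`. [folklore] -/
theorem wilson_klDiv_map_le_explicit (L : ℕ) [NeZero L] (β' : ℝ) (z : (GaugeConfig 3 L (Matrix.specialUnitaryGroup (Fin 2) ℂ))) :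
    ∀ {Ω : Type} [MeasurableSpace Ω] {P : Measure Ω} [IsProbabilityMeasure P]
      {W : ℝ≥0 → Ω → (Edge 3 L × NoiseIdx 2 → ℝ)} (hW : IsFlatBrownian W P)
      {U : ℝ≥0 → Ω → (GaugeConfig 3 L (Matrix.specialUnitaryGroup (Fin 2) ℂ))}, (∀ ω, U 0 ω = z) →
      (latticeLangevinDynamics (fundamentalLatticeRep 2) β').IsSolution (fundamentalRep (Fin 2)) hW.natFiltration P W U →
      ∀ s : ℝ≥0, klDiv (P.map (U ((2 : ℝ≥0) + s))) (wilsonMeasure (d := 3) (L := L) (fundamentalRep (Fin 2)) β') ≤ ENNReal.ofReal (366 * |β'| * (L : ℝ) ^ 3 + 3 * Real.log (3 / 2) * (L : ℝ) ^ 3 + Real.log 2) := by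
  intro Ω _ P _ W hW U hU0 hU s
  classical
  haveI := secondCountableTopology_su2
  haveI := borelSpace_config L
  haveI : IsProbabilityMeasure (wilsonMeasure (d := 3) (L := L) (fundamentalRep (Fin 2)) β') :=
    isProbabilityMeasure_wilsonMeasure (d := 3) (L := L) (fundamentalRep (Fin 2)) (continuous_fundamentalRep (Fin 2)) β'
  have ht₁ : (2 : ℝ) ≤ ((2 : ℝ≥0) : ℝ) := by norm_num
  have h1 := map_le_smul_haar_of_le_explicit (L := L) β' ht₁ z hW hU0 hU s
  obtain ⟨-, hπμ⟩ := wilsonMeasure_le_smul_pi_haar_and_explicit (L := L) β'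
  have hkey := densityConstant_mul_le_exp_budget L β'
  have hC0 : 0 ≤ ((Real.exp ((48 * |β'| * (Fintype.card (Edge 3 L) : ℝ)) * ((2 : ℝ≥0) : ℝ) + (2 * |β'| * (Fintype.card (Plaquette 3 L) : ℝ))) * (2 * (3 / 2 : ℝ) ^ Fintype.card (Edge 3 L))) * ((Real.exp (|β'| * (4 * (Fintype.card (Plaquette 3 L) : ℝ))) * Real.exp (|β'| * (4 * (Fintype.card (Plaquette 3 L) : ℝ)))) * (Real.exp (|β'| * (4 * (Fintype.card (Plaquette 3 L) : ℝ))) * Real.exp (|β'| * (4 * (Fintype.card (Plaquette 3 L) : ℝ)))))) := by positivity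
  -- abstract the constants
  obtain ⟨C, hCdef⟩ : ∃ C : ℝ, ((Real.exp ((48 * |β'| * (Fintype.card (Edge 3 L) : ℝ)) * ((2 : ℝ≥0) : ℝ) + (2 * |β'| * (Fintype.card (Plaquette 3 L) : ℝ))) * (2 * (3 / 2 : ℝ) ^ Fintype.card (Edge 3 L))) * ((Real.exp (|β'| * (4 * (Fintype.card (Plaquette 3 L) : ℝ))) * Real.exp (|β'| * (4 * (Fintype.card (Plaquette 3 L) : ℝ)))) * (Real.exp (|β'| * (4 * (Fintype.card (Plaquette 3 L) : ℝ))) * Real.exp (|β'| * (4 * (Fintype.card (Plaquette 3 L) : ℝ)))))) = C := ⟨_, rfl⟩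
  obtain ⟨a, hadef⟩ : ∃ a : ℝ, (Real.exp (|β'| * (4 * (Fintype.card (Plaquette 3 L) : ℝ))) * Real.exp (|β'| * (4 * (Fintype.card (Plaquette 3 L) : ℝ)))) = a := ⟨_, rfl⟩
  rw [hCdef] at h1 hC0 hkey
  rw [hadef] at hπμ hkey
  have hmU : ∀ t : ℝ≥0, Measurable (U t) := fun t => (hU.adapted t).mono (hW.natFiltration.le t) le_rfl
  haveI : IsProbabilityMeasure (P.map (U ((2 : ℝ≥0) + s))) := Measure.isProbabilityMeasure_map (hmU _).aemeasurable
  -- `law ≤ C·π ≤ (C·a)·μ ≤ max 1 (C a) · μ`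
  have h2 : P.map (U ((2 : ℝ≥0) + s)) ≤ (ENNReal.ofReal (max 1 (C * a))) • (wilsonMeasure (d := 3) (L := L) (fundamentalRep (Fin 2)) β') := by
    rw [Measure.le_iff]
    intro S hS
    have e1 := (Measure.le_iff.1 h1) S hS
    have e2 := (Measure.le_iff.1 hπμ) S hS
    simp only [Measure.smul_apply, smul_eq_mul] at e1 e2 ⊢
    calc P.map (U ((2 : ℝ≥0) + s)) S ≤ ENNReal.ofReal C * (Measure.pi fun _ : Edge 3 L => haarProbability (Matrix.specialUnitaryGroup (Fin 2) ℂ)) S := e1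
      _ ≤ ENNReal.ofReal C * (ENNReal.ofReal a * (wilsonMeasure (d := 3) (L := L) (fundamentalRep (Fin 2)) β') S) := mul_le_mul' le_rfl e2
      _ = ENNReal.ofReal (C * a) * (wilsonMeasure (d := 3) (L := L) (fundamentalRep (Fin 2)) β') S := by rw [← mul_assoc, ← ENNReal.ofReal_mul hC0]
      _ ≤ ENNReal.ofReal (max 1 (C * a)) * (wilsonMeasure (d := 3) (L := L) (fundamentalRep (Fin 2)) β') S := mul_le_mul' (ENNReal.ofReal_le_ofReal (le_max_right _ _)) le_rfl
  have h3 := klDiv_le_log_of_le_smul (le_max_left _ _) h2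
  refine h3.trans (ENNReal.ofReal_le_ofReal ?_)
  -- `log (max 1 (C a)) ≤ B`
  have hBpos := burnInBudget_pos L β'
  rcases le_or_gt (C * a) 1 with hle | hgt
  · rw [max_eq_left hle, Real.log_one]; exact hBpos.le
  · rw [max_eq_right hgt.le]
    exact (Real.log_le_iff_le_exp (by linarith)).2 hkey

/-! ## §3. Explicit decay, observables and the mixing time at `|β'| < 1/12` -/

/-- ★★ **Explicit, volume-uniform decay of the cold-start relative entropy** at `|β'| < 1/12`:
`KL(law(U_(2+u)) ‖ μ_(β')) ≤ e^(−2(1−12|β'|)u) · (366|β'|L³ + 3 log(3/2) L³ + log 2)` for every solution from any deterministic start and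
every `u ≥ 0`. [cite: ShenZhuZhu2022, §4 Theorem 4.2] -/
theorem wilson_coldStart_klDiv_le_exp_explicit (L : ℕ) [NeZero L] (β' : ℝ) (hβ : |β'| < 1 / 12) (z : (GaugeConfig 3 L (Matrix.specialUnitaryGroup (Fin 2) ℂ))) :
    ∀ {Ω : Type} [MeasurableSpace Ω] {P : Measure Ω} [IsProbabilityMeasure P]
      {W : ℝ≥0 → Ω → (Edge 3 L × NoiseIdx 2 → ℝ)} (hW : IsFlatBrownian W P)
      {U : ℝ≥0 → Ω → (GaugeConfig 3 L (Matrix.specialUnitaryGroup (Fin 2) ℂ))}, (∀ ω, U 0 ω = z) →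
      (latticeLangevinDynamics (fundamentalLatticeRep 2) β').IsSolution (fundamentalRep (Fin 2)) hW.natFiltration P W U →
      ∀ u : ℝ≥0, klDiv (P.map (U ((2 : ℝ≥0) + u))) (wilsonMeasure (d := 3) (L := L) (fundamentalRep (Fin 2)) β') ≤
        ENNReal.ofReal (Real.exp (-(2 * (1 - 12 * |β'|)) * u) * (366 * |β'| * (L : ℝ) ^ 3 + 3 * Real.log (3 / 2) * (L : ℝ) ^ 3 + Real.log 2)) := by
  intro Ω _ P _ W hW U hU0 hU u
  have ht₁ : 0 < ((2 : ℝ≥0) : ℝ) := by norm_num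
  have hdec := wilson_klDiv_map_le_exp_uniform L β' hβ hW z hU0 hU ht₁ u
  have hb := wilson_klDiv_map_le_explicit L β' z hW hU0 hU 0
  rw [add_zero] at hb
  have hBpos := burnInBudget_pos L β'
  have hK : (klDiv (P.map (U (2 : ℝ≥0))) (wilsonMeasure (d := 3) (L := L) (fundamentalRep (Fin 2)) β')).toReal ≤ (366 * |β'| * (L : ℝ) ^ 3 + 3 * Real.log (3 / 2) * (L : ℝ) ^ 3 + Real.log 2) := by
    have h := ENNReal.toReal_mono ENNReal.ofReal_ne_top hb
    rwa [ENNReal.toReal_ofReal hBpos.le] at h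
  refine hdec.trans (ENNReal.ofReal_le_ofReal ?_)
  exact mul_le_mul_of_nonneg_left hK (Real.exp_pos _).le

/-- ★★★ **Explicit cold-start mixing of bounded observables, uniform in the volume and in the start** (`|β'| < 1/12`): for every
measurable `|g| ≤ 1`, every deterministic start, every solution and every `u ≥ 0`,
`|E g(U_(2+u)) − ∫ g dμ_(β')| ≤ e^(−(1−12|β'|)u) · √(2·(366|β'|L³ + 3 log(3/2) L³ + log 2))`. [cite: ShenZhuZhu2022, §4 Theorem 4.2] -/
theorem wilson_coldStart_observable_le_exp_explicit (L : ℕ) [NeZero L] (β' : ℝ) (hβ : |β'| < 1 / 12) (z : (GaugeConfig 3 L (Matrix.specialUnitaryGroup (Fin 2) ℂ)))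
    {Ω : Type} [MeasurableSpace Ω] {P : Measure Ω} [IsProbabilityMeasure P]
    {W : ℝ≥0 → Ω → (Edge 3 L × NoiseIdx 2 → ℝ)} (hW : IsFlatBrownian W P)
    {U : ℝ≥0 → Ω → (GaugeConfig 3 L (Matrix.specialUnitaryGroup (Fin 2) ℂ))} (hU0 : ∀ ω, U 0 ω = z)
    (hU : (latticeLangevinDynamics (fundamentalLatticeRep 2) β').IsSolution (fundamentalRep (Fin 2)) hW.natFiltration P W U)
    (u : ℝ≥0) {g : (GaugeConfig 3 L (Matrix.specialUnitaryGroup (Fin 2) ℂ)) → ℝ} (hgm : Measurable g) (hgb : ∀ x, |g x| ≤ 1) :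
    |(∫ ω, g (U ((2 : ℝ≥0) + u) ω) ∂P) - ∫ x, g x ∂(wilsonMeasure (d := 3) (L := L) (fundamentalRep (Fin 2)) β')| ≤
      Real.exp (-(1 - 12 * |β'|) * u) * Real.sqrt (2 * (366 * |β'| * (L : ℝ) ^ 3 + 3 * Real.log (3 / 2) * (L : ℝ) ^ 3 + Real.log 2)) := by
  have ht₁ : 0 < ((2 : ℝ≥0) : ℝ) := by norm_num
  have h := wilson_coldStart_observable_le_exp_uniform L β' hβ hW z hU0 hU ht₁ u hgm hgb
  have hb := wilson_klDiv_map_le_explicit L β' z hW hU0 hU 0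
  rw [add_zero] at hb
  have hBpos := burnInBudget_pos L β'
  have hK : (klDiv (P.map (U (2 : ℝ≥0))) (wilsonMeasure (d := 3) (L := L) (fundamentalRep (Fin 2)) β')).toReal ≤ (366 * |β'| * (L : ℝ) ^ 3 + 3 * Real.log (3 / 2) * (L : ℝ) ^ 3 + Real.log 2) := by
    have h' := ENNReal.toReal_mono ENNReal.ofReal_ne_top hb
    rwa [ENNReal.toReal_ofReal hBpos.le] at h'
  refine h.trans (mul_le_mul_of_nonneg_left (Real.sqrt_le_sqrt (by linarith)) (Real.exp_pos _).le)

/-- ★★★ **Logarithmic mixing time in the volume at strong coupling.**  For the SU(2) SZZ Langevin dynamics on `(ℤ/L)³` at `|β'| < 1/12`,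
with `B_L = 366|β'|L³ + 3 log(3/2) L³ + log 2`: for every `ε > 0` and every `u ≥ log(√(2 B_L)/ε) / (1 − 12|β'|)`, every measurable `|g| ≤ 1`,
every deterministic start and every solution, `|E g(U_(2+u)) − ∫ g dμ_(β')| ≤ ε`.  Hence the ε-mixing time (bounded observables / total
variation, uniformly in the start) is at most `2 + log(√(2B_L)/ε)/(1 − 12|β'|) = O(log L + log(1/ε))` lattice time units.
[cite: ShenZhuZhu2022, §4 Theorem 4.2, Corollary 4.4] -/
theorem wilson_coldStart_mixingTime_log_volume (L : ℕ) [NeZero L] (β' : ℝ) (hβ : |β'| < 1 / 12) (z : (GaugeConfig 3 L (Matrix.specialUnitaryGroup (Fin 2) ℂ)))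
    {Ω : Type} [MeasurableSpace Ω] {P : Measure Ω} [IsProbabilityMeasure P]
    {W : ℝ≥0 → Ω → (Edge 3 L × NoiseIdx 2 → ℝ)} (hW : IsFlatBrownian W P)
    {U : ℝ≥0 → Ω → (GaugeConfig 3 L (Matrix.specialUnitaryGroup (Fin 2) ℂ))} (hU0 : ∀ ω, U 0 ω = z)
    (hU : (latticeLangevinDynamics (fundamentalLatticeRep 2) β').IsSolution (fundamentalRep (Fin 2)) hW.natFiltration P W U)
    {ε : ℝ} (hε : 0 < ε) (u : ℝ≥0)
    (hu : Real.log (Real.sqrt (2 * (366 * |β'| * (L : ℝ) ^ 3 + 3 * Real.log (3 / 2) * (L : ℝ) ^ 3 + Real.log 2)) / ε) / (1 - 12 * |β'|) ≤ (u : ℝ))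
    {g : (GaugeConfig 3 L (Matrix.specialUnitaryGroup (Fin 2) ℂ)) → ℝ} (hgm : Measurable g) (hgb : ∀ x, |g x| ≤ 1) :
    |(∫ ω, g (U ((2 : ℝ≥0) + u) ω) ∂P) - ∫ x, g x ∂(wilsonMeasure (d := 3) (L := L) (fundamentalRep (Fin 2)) β')| ≤ ε := by
  have hρ : 0 < 1 - 12 * |β'| := by linarith
  have h := wilson_coldStart_observable_le_exp_explicit L β' hβ z hW hU0 hU u hgm hgb
  have hBpos := burnInBudget_pos L β'
  set S : ℝ := Real.sqrt (2 * (366 * |β'| * (L : ℝ) ^ 3 + 3 * Real.log (3 / 2) * (L : ℝ) ^ 3 + Real.log 2)) with hS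
  have hSpos : 0 < S := Real.sqrt_pos.2 (by linarith)
  refine h.trans ?_
  -- `e^(−ρu) ≤ ε / S`
  have hu' : Real.log (S / ε) ≤ (1 - 12 * |β'|) * u := by
    rw [div_le_iff₀ hρ] at hu
    linarith
  have hexp : Real.exp (-(1 - 12 * |β'|) * u) ≤ ε / S := by
    have h1 : Real.exp (-(1 - 12 * |β'|) * u) ≤ Real.exp (-Real.log (S / ε)) := Real.exp_le_exp.2 (by linarith)
    rw [Real.exp_neg, Real.exp_log (div_pos hSpos hε), inv_div] at h1
    exact h1
  calc Real.exp (-(1 - 12 * |β'|) * u) * S ≤ ε / S * S := mul_le_mul_of_nonneg_right hexp hSpos.le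
    _ = ε := div_mul_cancel₀ ε hSpos.ne'

end Summit.QuantumFields.YangMills.Theorems.ColdStartUniversality
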